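import Mathlib
import Literature.Probability.Process.PointStationaryLaw
import Literature.Geometry.DiscreteGeometry.CrystallographicGroups
import Summits.AtomisticToContinuum.Crystallization.Theorems.IsometryAtomsMinimisingLawsCohesiveFiniteOrbitsOfChargedAux1

/-!
# Charged copies are separated and non-coplanar; bounded stabilisers of a discontinuous symmetry group

Auxiliary file 3 for stub `stub_finiteOrbitsOfCharged` of line `purity_stacking` of crux
`IsometryAtoms.MinimisingLawsCohesive` (stmt-AtomisticToContinuum-15777): the deterministic inputs of
the finiteness-of-orbits argument, in `ℝ³`.

* `sep_of_copy_eq_hardCore` — if a rooted copy `count|A(Y - q)` of `Y` is a rooted `δ`-hard-core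
  configuration, then `Y` is `δ`-separated;
* `coplanar_imp_slab` — if `Y` lies in an affine plane `{⟪y, n⟫ = c}` (`n ≠ 0`), then every copy
  `count|A(Y - q)` is a SLAB: after a suitable linear isometry (a reflection taking the unit normal
  `A n / ‖n‖` to `e₀`) its atoms have bounded first coordinate;
* `finite_iso_of_finite_affine` — finiteness of `{g : ℝ³ ≃ᵃⁱ ℝ³ | g '' Y = Y, ‖x‖ ≤ R, ‖g x‖ ≤ R}`
  transfers to the same set of isometries `ℝ³ ≃ᵢ ℝ³` (Mazur–Ulam, `toRealAffineIsometryEquiv` is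
  injective);
* `finiteOrbits_exists_card_stab_le` (anchor) — if such sets are finite for every `R`, the symmetry
  group `{g | g '' Y = Y}` acts discontinuously, so a uniform bound on the orders of the finite
  subgroups of discontinuous groups (conjunct (i) of the neighbour stub `stub_groupStructure`) bounds
  the orders of all stabilisers `{g | g '' Y = Y ∧ g b = b}` uniformly in `b`.
-/

noncomputable section

open MeasureTheory Set Metric
open scoped ENNReal RealInnerProductSpace

namespace Summit.AtomisticToContinuum.Crystallization.Theorems.IsometryAtomsMinimisingLawsCohesive.FiniteOrbitsOfCharged

open Literature.Probability.Process (IsRootedHardCore count_restrict_singleton_ne_zero_iff)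
open Summit.AtomisticToContinuum.Crystallization.Theorems.PricedHcpWindowsAllPointsOfRoot (eq_of_count_restrict_eq)
open Literature.Geometry.DiscreteGeometry.Crystallographic (IsDiscontinuous)

/-! ## A charged copy is separated -/

/-- If the copy `count|A(Y - q)` is a rooted `δ`-hard-core configuration then `Y` is `δ`-separated
(the copy map `s ↦ A(s - q)` is an isometric injection onto the hard-core carrier). -/
theorem sep_of_copy_eq_hardCore {Y : Set (EuclideanSpace ℝ (Fin 3))} {δ : ℝ}
    {A : EuclideanSpace ℝ (Fin 3) →ₗᵢ[ℝ] EuclideanSpace ℝ (Fin 3)} {q : EuclideanSpace ℝ (Fin 3)}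
    (h : IsRootedHardCore δ ((Measure.count : Measure (EuclideanSpace ℝ (Fin 3))).restrict
      ((fun s => A (s - q)) '' Y))) :
    ∀ x ∈ Y, ∀ y ∈ Y, x ≠ y → δ ≤ dist x y := by
  obtain ⟨S, -, hS, hμ⟩ := h
  have hZS : (fun s => A (s - q)) '' Y = S := eq_of_count_restrict_eq hμ
  intro x hx y hy hxy
  have hx' : A (x - q) ∈ S := hZS ▸ mem_image_of_mem (fun s => A (s - q)) hx
  have hy' : A (y - q) ∈ S := hZS ▸ mem_image_of_mem (fun s => A (s - q)) hy
  have hne : A (x - q) ≠ A (y - q) := fun hxy' => hxy (sub_left_injective (A.injective hxy'))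
  have hd := hS _ hx' _ hy' hne
  rwa [dist_eq_norm, ← map_sub, LinearIsometry.norm_map, sub_sub_sub_cancel_right, ← dist_eq_norm] at hd

/-! ## Coplanar point sets give slabs -/

/-- **A coplanar `Y` gives slab copies**: if `⟪y, n⟫ = c` for all `y ∈ Y` with `n ≠ 0`, then for every
copy `count|A(Y - q)` there are a linear isometry `B` and a bound `D` with `|(B y) 0| ≤ D` for every atom
`y` of the copy (`B` = a reflection taking the unit vector `A n / ‖n‖` to `e₀`, `D = |c - ⟪q, n⟫| / ‖n‖`). -/
theorem coplanar_imp_slab {Y : Set (EuclideanSpace ℝ (Fin 3))} {n : EuclideanSpace ℝ (Fin 3)} (hn : n ≠ 0)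
    {c : ℝ} (hc : ∀ y ∈ Y, ⟪y, n⟫ = c) (A : EuclideanSpace ℝ (Fin 3) →ₗᵢ[ℝ] EuclideanSpace ℝ (Fin 3))
    (q : EuclideanSpace ℝ (Fin 3)) :
    ∃ B : EuclideanSpace ℝ (Fin 3) →ₗᵢ[ℝ] EuclideanSpace ℝ (Fin 3), ∃ D : ℝ,
      ∀ y : EuclideanSpace ℝ (Fin 3), (Measure.count : Measure (EuclideanSpace ℝ (Fin 3))).restrict
        ((fun s => A (s - q)) '' Y) {y} ≠ 0 → |B y 0| ≤ D := by
  set u : EuclideanSpace ℝ (Fin 3) := ‖n‖⁻¹ • A n with hu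
  set e₀ : EuclideanSpace ℝ (Fin 3) := EuclideanSpace.single 0 1 with he₀
  have hnorm : ‖n‖ ≠ 0 := norm_ne_zero_iff.2 hn
  have hu1 : ‖u‖ = 1 := by
    rw [hu, norm_smul, norm_inv, norm_norm, LinearIsometry.norm_map, inv_mul_cancel₀ hnorm]
  have he1 : ‖e₀‖ = 1 := by simp [he₀]
  set R : EuclideanSpace ℝ (Fin 3) ≃ₗᵢ[ℝ] EuclideanSpace ℝ (Fin 3) := (ℝ ∙ (u - e₀))ᗮ.reflection with hR
  have hRu : R u = e₀ := Submodule.reflection_sub (by rw [hu1, he1])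
  refine ⟨R.toLinearIsometry, |‖n‖⁻¹ * (c - ⟪q, n⟫)|, fun y hy => ?_⟩
  rw [count_restrict_singleton_ne_zero_iff] at hy
  obtain ⟨s, hs, rfl⟩ := hy
  have h0 : (R.toLinearIsometry (A (s - q))) 0 = ⟪R (A (s - q)), e₀⟫ := by
    rw [he₀, EuclideanSpace.inner_single_right]
    simp
  have h1 : ⟪R (A (s - q)), e₀⟫ = ⟪A (s - q), u⟫ := by
    rw [← hRu, LinearIsometryEquiv.inner_map_map]
  have h2 : ⟪A (s - q), u⟫ = ‖n‖⁻¹ * (c - ⟪q, n⟫) := by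
    rw [hu, inner_smul_right, LinearIsometry.inner_map_map, inner_sub_left, hc s hs]
  rw [h0, h1, h2]

/-! ## From affine isometries to isometries (Mazur–Ulam) -/

/-- `IsometryEquiv.toRealAffineIsometryEquiv` is injective (it does not change the underlying map). -/
theorem toRealAffineIsometryEquiv_injective :
    Function.Injective (IsometryEquiv.toRealAffineIsometryEquiv :
      (EuclideanSpace ℝ (Fin 3) ≃ᵢ EuclideanSpace ℝ (Fin 3)) →
        (EuclideanSpace ℝ (Fin 3) ≃ᵃⁱ[ℝ] EuclideanSpace ℝ (Fin 3))) := by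
  intro g g' h
  ext x
  rw [← IsometryEquiv.coeFn_toRealAffineIsometryEquiv g, h, IsometryEquiv.coeFn_toRealAffineIsometryEquiv]

/-- **Finiteness transfer**: if the affine isometries `g` with `g '' Y = Y` moving some point of norm
`≤ R` to a point of norm `≤ R` are finitely many, so are such isometries. -/
theorem finite_iso_of_finite_affine {Y : Set (EuclideanSpace ℝ (Fin 3))} {R : ℝ}
    (h : {g : EuclideanSpace ℝ (Fin 3) ≃ᵃⁱ[ℝ] EuclideanSpace ℝ (Fin 3) |
      g '' Y = Y ∧ ∃ x : EuclideanSpace ℝ (Fin 3), ‖x‖ ≤ R ∧ ‖g x‖ ≤ R}.Finite) :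
    {g : EuclideanSpace ℝ (Fin 3) ≃ᵢ EuclideanSpace ℝ (Fin 3) |
      g '' Y = Y ∧ ∃ x : EuclideanSpace ℝ (Fin 3), ‖x‖ ≤ R ∧ ‖g x‖ ≤ R}.Finite := by
  refine Set.Finite.of_finite_image (h.subset ?_) toRealAffineIsometryEquiv_injective.injOn
  rintro _ ⟨g, ⟨hgY, x, hx, hgx⟩, rfl⟩
  refine ⟨?_, x, hx, ?_⟩
  · rw [IsometryEquiv.coeFn_toRealAffineIsometryEquiv]
    exact hgY
  · rw [IsometryEquiv.coeFn_toRealAffineIsometryEquiv]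
    exact hgx

/-! ## Discontinuity of the symmetry group and bounded stabilisers -/

/-- If the symmetries of `Y` moving some point of norm `≤ R` to a point of norm `≤ R` are finitely
many for every `R`, then every subgroup of isometries consisting of symmetries of `Y` acts
discontinuously. -/
theorem isDiscontinuous_of_finite {Y : Set (EuclideanSpace ℝ (Fin 3))}
    (hfin : ∀ R : ℝ, {g : EuclideanSpace ℝ (Fin 3) ≃ᵢ EuclideanSpace ℝ (Fin 3) |
      g '' Y = Y ∧ ∃ x : EuclideanSpace ℝ (Fin 3), ‖x‖ ≤ R ∧ ‖g x‖ ≤ R}.Finite)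
    (Γ : Subgroup (EuclideanSpace ℝ (Fin 3) ≃ᵢ EuclideanSpace ℝ (Fin 3)))
    (hΓ : ∀ g ∈ Γ, g '' Y = Y) : IsDiscontinuous Γ := by
  intro K hK
  obtain ⟨R, hR⟩ := hK.isBounded.subset_closedBall 0
  refine (hfin R).subset ?_
  rintro g ⟨hg, z, ⟨x, hx, rfl⟩, hz⟩
  exact ⟨hΓ g hg, x, mem_closedBall_zero_iff.1 (hR hx), mem_closedBall_zero_iff.1 (hR hz)⟩

/-- **Registered helper** `finiteOrbits_exists_card_stab_le` (anchor of this file): if the finite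
subgroups of every discontinuous group of isometries of `ℝ³` have uniformly bounded order (conjunct (i)
of the group-structure hypothesis), and the symmetries of `Y` moving some point of norm `≤ R` to a
point of norm `≤ R` are finitely many for every `R`, then the stabilisers `{g | g '' Y = Y ∧ g b = b}`
have uniformly bounded order. -/
theorem finiteOrbits_exists_card_stab_le : ∀ (Y : Set (EuclideanSpace ℝ (Fin 3))), (∀ Γ : Subgroup (EuclideanSpace ℝ (Fin 3) ≃ᵢ EuclideanSpace ℝ (Fin 3)), Literature.Geometry.DiscreteGeometry.Crystallographic.IsDiscontinuous Γ → ∃ N : ℕ, ∀ H : Subgroup (EuclideanSpace ℝ (Fin 3) ≃ᵢ EuclideanSpace ℝ (Fin 3)), H ≤ Γ → Finite H → Nat.card H ≤ N) → (∀ R : ℝ, {g : EuclideanSpace ℝ (Fin 3) ≃ᵢ EuclideanSpace ℝ (Fin 3) | g '' Y = Y ∧ ∃ x : EuclideanSpace ℝ (Fin 3), ‖x‖ ≤ R ∧ ‖g x‖ ≤ R}.Finite) → ∃ N : ℕ, ∀ b : EuclideanSpace ℝ (Fin 3), Nat.card {g : EuclideanSpace ℝ (Fin 3) ≃ᵢ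 EuclideanSpace ℝ (Fin 3) // g '' Y = Y ∧ g b = b} ≤ N := by
  intro Y hGS hfin
  let Γ : Subgroup (EuclideanSpace ℝ (Fin 3) ≃ᵢ EuclideanSpace ℝ (Fin 3)) :=
    { carrier := {g | g '' Y = Y}
      one_mem' := by
        show (⇑(1 : EuclideanSpace ℝ (Fin 3) ≃ᵢ EuclideanSpace ℝ (Fin 3))) '' Y = Y
        rw [IsometryEquiv.coe_one, Set.image_id]
      mul_mem' := fun hg hh => mul_image_eq hg hh
      inv_mem' := fun hg => symm_image_eq hg }
  have hΓ : ∀ g ∈ Γ, g '' Y = Y := fun g hg => hg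
  obtain ⟨N, hN⟩ := hGS Γ (isDiscontinuous_of_finite hfin Γ hΓ)
  refine ⟨N, fun b => ?_⟩
  let H : Subgroup (EuclideanSpace ℝ (Fin 3) ≃ᵢ EuclideanSpace ℝ (Fin 3)) :=
    { carrier := {g | g '' Y = Y ∧ g b = b}
      one_mem' := by
        refine ⟨?_, rfl⟩
        show (⇑(1 : EuclideanSpace ℝ (Fin 3) ≃ᵢ EuclideanSpace ℝ (Fin 3))) '' Y = Y
        rw [IsometryEquiv.coe_one, Set.image_id]
      mul_mem' := fun {g h} hg hh => ⟨mul_image_eq hg.1 hh.1, by rw [IsometryEquiv.mul_apply, hh.2, hg.2]⟩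
      inv_mem' := fun {g} hg => ⟨symm_image_eq hg.1, by
        show g.symm b = b
        conv_lhs => rw [← hg.2]
        exact g.symm_apply_apply b⟩ }
  have hHle : H ≤ Γ := fun g hg => hg.1
  have hHfin : Finite H := (finite_stab hfin b).to_subtype
  calc Nat.card {g : EuclideanSpace ℝ (Fin 3) ≃ᵢ EuclideanSpace ℝ (Fin 3) // g '' Y = Y ∧ g b = b}
      = Nat.card H := Nat.card_congr (Equiv.subtypeEquivRight fun _ => Iff.rfl)
    _ ≤ N := hN H hHle hHfin

end Summit.AtomisticToContinuum.Crystallization.Theorems.IsometryAtomsMinimisingLawsCohesive.FiniteOrbitsOfCharged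

end
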